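import Summits.CriticalPhenomena.PercolationContinuityZ3.Theorems.Transplant.FKThreeApexNegCorr
import HarnessLib

/-!
# Connectivity correlation inequalities for `φ_{w,q}` — the three-apex family: the TRIANGLE LETTERS of `K_{1,1,1,n}` (pairs, rigid triangle, cluster count)

Support file (`--supports stmt-CriticalPhenomena-4575`), FK sub-lane `prim-bschramm-fk-3` (gen 13); builds on p205010 (kernel theorem, internal audit
signed; external expert review pending).  No named facts, no sorries; standard axioms.  Layer 2c-i of the `K_{1,1,1,n}` programme (memo
`bschramm/prim-bschramm-fk-3/THREE-APEX.md` §6), the combinatorial half of the transfer formula for weight vectors supported on the apex–leaf pairs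
AND the triangle `ab, ac, bc` (`…ThreeApexWordTri`): the pair sets `triPairs`, `fullPairs`; the product `triLetter` of the three triangle letters
(`…ThreeApexAlgebra`) in the commutative monoid `(V5, conv, δ_0)` (`…ThreeApexNegCorr`) and the transfer expression `transfer3T`; affinity of the edge
letters (`affC_edgeXY_mul`); at a rigid weight vector the triangle letters give the basis vector of the apex partition `triState` generated by the
open triangle edges (`triLetter_rigid`), the open triangle edges form the configuration `triConf` whose apex reachability is read off `triState`
(`reach_triConf_*`) and whose cluster count is `|V| − 3 + blocks(triState)` (`clusterCount_triConf`); membership in `conf` started from an initial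
configuration (`mem_conf_iff`) and rigid leaf products on a basis vector (`prod_leafB_mul_basisVec`). [cite: Grimmett2006, §1.2 eq. (1.1) (p. 4); §1.4 eq. (1.20) (p. 15)] [folklore]
-/

noncomputable section

namespace Summit.CriticalPhenomena.PercolationContinuityZ3.Theorems

namespace FK

namespace ThreeApex

open Literature.Probability.LatticeModels Literature.Probability.Percolation
open scoped Classical

variable {V : Type*} [Fintype V]

/-! ### The pairs and the letters of `K_{1,1,1,n}` -/

/-- The three apex–apex pairs. [folklore] -/
def triPairs (a b c : V) : Finset (Sym2 V) := {s(a, b), s(a, c), s(b, c)}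

/-- All pairs of `K_{1,1,1,n}`: apex–leaf pairs and the triangle. [folklore] -/
def fullPairs (a b c : V) (v : ℕ → V) (n : ℕ) : Finset (Sym2 V) := apexPairs a b c v n ∪ triPairs a b c

/-- The product of the three triangle letters read off the weight vector. [folklore] -/
def triLetter (w : Sym2 V → unitInterval) (a b c : V) : V5 :=
  edgeAB ((w s(a, b) : unitInterval) : ℝ) * (edgeAC ((w s(a, c) : unitInterval) : ℝ) * edgeBC ((w s(b, c) : unitInterval) : ℝ))

/-- The transfer expression of `K_{1,1,1,n}`: the valuation of (triangle letters) · (leaf letters). [folklore] -/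
def transfer3T (q : ℝ) (w : Sym2 V → unitInterval) (a b c : V) (v : ℕ → V) (n : ℕ) : ℝ :=
  val q (triLetter w a b c * zvec q w a b c v n)

omit [Fintype V] in
/-- Membership in `triPairs`. [folklore] -/
theorem mem_triPairs_iff (a b c : V) (e : Sym2 V) : e ∈ triPairs a b c ↔ e = s(a, b) ∨ e = s(a, c) ∨ e = s(b, c) := by
  simp [triPairs]

omit [Fintype V] in
/-- Membership in `fullPairs`. [folklore] -/
theorem mem_fullPairs_iff (a b c : V) (v : ℕ → V) (n : ℕ) (e : Sym2 V) :
    e ∈ fullPairs a b c v n ↔ e ∈ apexPairs a b c v n ∨ e ∈ triPairs a b c := by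
  simp [fullPairs]

/-! ### Affinity of the edge letters -/

/-- `edgeAB t · M` is affine in `t`. [folklore] -/
theorem affC_edgeAB_mul (t : ℝ) (M : V5) : AffC t (edgeAB t * M) (edgeAB 0 * M) (edgeAB 1 * M) := by
  refine ⟨?_, ?_, ?_, ?_, ?_⟩ <;> simp only [mul_def, conv, edgeAB, V5.total] <;> ring

/-- `edgeAC t · M` is affine in `t`. [folklore] -/
theorem affC_edgeAC_mul (t : ℝ) (M : V5) : AffC t (edgeAC t * M) (edgeAC 0 * M) (edgeAC 1 * M) := by
  refine ⟨?_, ?_, ?_, ?_, ?_⟩ <;> simp only [mul_def, conv, edgeAC, V5.total] <;> ring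

/-- `edgeBC t · M` is affine in `t`. [folklore] -/
theorem affC_edgeBC_mul (t : ℝ) (M : V5) : AffC t (edgeBC t * M) (edgeBC 0 * M) (edgeBC 1 * M) := by
  refine ⟨?_, ?_, ?_, ?_, ?_⟩ <;> simp only [mul_def, conv, edgeBC, V5.total] <;> ring

/-! ### The triangle at a rigid weight vector: the partition `triState` and the configuration `triConf` -/

/-- The apex partition generated by the open triangle edges (`x`: `ab` open, `y`: `ac` open, `z`: `bc` open). [folklore] -/
def triState (x y z : Bool) : P3 :=
  let s₁ := if z then P3.bot.joinBC else P3.bot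
  let s₂ := if y then s₁.joinAC else s₁
  if x then s₂.joinAB else s₂

/-- The rigid triangle letters act on `δ_0` as the basis vector of `triState`. [folklore] -/
theorem triLetter_rigid (x y z : Bool) :
    edgeAB (bR x) * (edgeAC (bR y) * edgeBC (bR z)) = basisVec (triState x y z) := by
  cases x <;> cases y <;> cases z <;>
    (ext <;> simp [mul_def, conv, edgeAB, edgeAC, edgeBC, bR, basisVec, triState, P3.joinAB, P3.joinAC, P3.joinBC, V5.total])

/-- Blocks of `triState`: `3 − [z] − [y] − [x ∧ ¬(y ∧ z)]`. [folklore] -/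
theorem blocks_triState (x y z : Bool) :
    (triState x y z).blocks + (if z then 1 else 0) + (if y then 1 else 0) + (if x then (if y && z then 0 else 1) else 0) = 3 := by
  cases x <;> cases y <;> cases z <;> decide

/-- The open triangle edges as a configuration (nested inserts: `bc`, then `ac`, then `ab`). [folklore] -/
def triConf (a b c : V) (x y z : Bool) : Finset (Sym2 V) :=
  let ω₁ : Finset (Sym2 V) := if z then insert s(b, c) ∅ else ∅
  let ω₂ : Finset (Sym2 V) := if y then insert s(a, c) ω₁ else ω₁
  if x then insert s(a, b) ω₂ else ω₂

omit [Fintype V] in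
/-- Membership in `triConf`. [folklore] -/
theorem mem_triConf_iff (a b c : V) (x y z : Bool) (e : Sym2 V) :
    e ∈ triConf a b c x y z ↔ (x = true ∧ e = s(a, b)) ∨ (y = true ∧ e = s(a, c)) ∨ (z = true ∧ e = s(b, c)) := by
  cases x <;> cases y <;> cases z <;> simp [triConf]

omit [Fintype V] in
/-- Every pair of `triConf` joins two apices. [folklore] -/
theorem triConf_apex (a b c : V) (x y z : Bool) : ∀ e ∈ triConf a b c x y z, ∀ w ∈ e, w = a ∨ w = b ∨ w = c := by
  intro e he w hw
  rcases (mem_triConf_iff a b c x y z e).1 he with ⟨-, rfl⟩ | ⟨-, rfl⟩ | ⟨-, rfl⟩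
  · rcases Sym2.mem_iff.1 hw with rfl | rfl
    · exact Or.inl rfl
    · exact Or.inr (Or.inl rfl)
  · rcases Sym2.mem_iff.1 hw with rfl | rfl
    · exact Or.inl rfl
    · exact Or.inr (Or.inr rfl)
  · rcases Sym2.mem_iff.1 hw with rfl | rfl
    · exact Or.inr (Or.inl rfl)
    · exact Or.inr (Or.inr rfl)

omit [Fintype V] in
/-- Reachability in the empty configuration is equality. [folklore] -/
theorem reachable_empty_iff (y z : V) : (openGraph (↑(∅ : Finset (Sym2 V)) : BondConfig V)).Reachable y z ↔ y = z := by
  constructor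
  · intro h
    by_contra hne
    exact Wheel.not_reachable_of_fresh (ω := (∅ : Finset (Sym2 V))) (u := z) (by simp) hne h
  · rintro rfl; exact SimpleGraph.Reachable.refl _

section TriConf

variable {a b c : V} (hab : a ≠ b) (hac : a ≠ c) (hbc : b ≠ c)
include hab hac hbc

omit [Fintype V] in
/-- Reachability of the apices in the triangle configuration is read off `triState`: `a ↔ b`. [folklore] -/
theorem reach_triConf_ab (x y z : Bool) :
    (openGraph (↑(triConf a b c x y z) : BondConfig V)).Reachable a b ↔ (triState x y z).rAB = true := by
  have hba := hab.symm; have hca := hac.symm; have hcb := hbc.symm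
  cases x <;> cases y <;> cases z <;>
    simp only [triConf, triState, P3.rAB, P3.joinAB, P3.joinAC, P3.joinBC, Bool.false_eq_true, ↓reduceIte, Wheel.reachable_coe_insert_iff, reachable_empty_iff,
      hab, hac, hbc, hba, hca, hcb] <;> tauto

omit [Fintype V] in
/-- Reachability of the apices in the triangle configuration: `a ↔ c`. [folklore] -/
theorem reach_triConf_ac (x y z : Bool) :
    (openGraph (↑(triConf a b c x y z) : BondConfig V)).Reachable a c ↔ (triState x y z).rAC = true := by
  have hba := hab.symm; have hca := hac.symm; have hcb := hbc.symm
  cases x <;> cases y <;> cases z <;>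
    simp only [triConf, triState, P3.rAC, P3.joinAB, P3.joinAC, P3.joinBC, Bool.false_eq_true, ↓reduceIte, Wheel.reachable_coe_insert_iff, reachable_empty_iff,
      hab, hac, hbc, hba, hca, hcb] <;> tauto

omit [Fintype V] in
/-- Reachability of the apices in the triangle configuration: `b ↔ c`. [folklore] -/
theorem reach_triConf_bc (x y z : Bool) :
    (openGraph (↑(triConf a b c x y z) : BondConfig V)).Reachable b c ↔ (triState x y z).rBC = true := by
  have hba := hab.symm; have hca := hac.symm; have hcb := hbc.symm
  cases x <;> cases y <;> cases z <;>
    simp only [triConf, triState, P3.rBC, P3.joinAB, P3.joinAC, P3.joinBC, Bool.false_eq_true, ↓reduceIte, Wheel.reachable_coe_insert_iff, reachable_empty_iff,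
      hab, hac, hbc, hba, hca, hcb] <;> tauto

/-- **Cluster count of the triangle configuration**: `k(triConf) + 3 = |V| + blocks(triState)`. [cite: Grimmett2006, §1.2 eq. (1.1) (p. 4)] -/
theorem clusterCount_triConf (x y z : Bool) :
    clusterCount (↑(triConf a b c x y z) : BondConfig V) (∅ : Set V) + 3 = Fintype.card V + (triState x y z).blocks := by
  have hba := hab.symm; have hca := hac.symm; have hcb := hbc.symm
  -- stage 1: `bc`
  set ω₁ : Finset (Sym2 V) := if z then insert s(b, c) ∅ else ∅ with hω₁
  have k1 : clusterCount (↑ω₁ : BondConfig V) (∅ : Set V) + (if z then 1 else 0) = Fintype.card V := by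
    rw [hω₁]; cases z
    · simp only [Bool.false_eq_true, ↓reduceIte, add_zero]; exact Wheel.clusterCount_emptyFinset
    · simp only [↓reduceIte]
      have h := Wheel.clusterCount_insert_of_not_reachable (∅ : Finset (Sym2 V)) (a := b) (b := c)
        (by rw [reachable_empty_iff]; exact hbc)
      rw [Wheel.clusterCount_emptyFinset] at h
      exact h
  -- stage 2: `ac` (`a` is fresh in `ω₁`)
  set ω₂ : Finset (Sym2 V) := if y then insert s(a, c) ω₁ else ω₁ with hω₂
  have hfresh : ∀ e ∈ ω₁, a ∉ e := by
    intro e he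
    rw [hω₁] at he
    cases z
    · simp at he
    · simp only [↓reduceIte, Finset.mem_insert, Finset.notMem_empty, or_false] at he
      subst he
      rw [Sym2.mem_iff, not_or]; exact ⟨hab, hac⟩
  have k2 : clusterCount (↑ω₂ : BondConfig V) (∅ : Set V) + (if y then 1 else 0) = clusterCount (↑ω₁ : BondConfig V) (∅ : Set V) := by
    rw [hω₂]; cases y
    · simp
    · simp only [↓reduceIte]
      have hnr : ¬ (openGraph (↑ω₁ : BondConfig V)).Reachable a c := fun h =>
        Wheel.not_reachable_of_fresh hfresh hca h.symm
      exact Wheel.clusterCount_insert_of_not_reachable ω₁ hnr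
  -- stage 3: `ab`
  have hr2 : (openGraph (↑ω₂ : BondConfig V)).Reachable a b ↔ (y && z) = true := by
    rw [hω₂, hω₁]
    cases y <;> cases z <;>
      simp only [Bool.and_self, Bool.and_false, Bool.and_true, Bool.false_eq_true, ↓reduceIte, Wheel.reachable_coe_insert_iff, reachable_empty_iff,
      hab, hac, hbc, hba, hca, hcb] <;> tauto
  have k3 : clusterCount (↑(triConf a b c x y z) : BondConfig V) (∅ : Set V) + (if x then (if y && z then 0 else 1) else 0) =
      clusterCount (↑ω₂ : BondConfig V) (∅ : Set V) := by
    have hT : triConf a b c x y z = if x then insert s(a, b) ω₂ else ω₂ := rfl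
    rw [hT]; cases x
    · simp
    · simp only [↓reduceIte]
      have h := Wheel.clusterCount_insert_free ω₂ a b
      by_cases hyz : (y && z) = true
      · rw [if_pos hyz]; rw [if_pos (hr2.2 hyz)] at h; exact h
      · rw [if_neg hyz]; rw [if_neg (fun h' => hyz (hr2.1 h'))] at h; exact h
  have hb := blocks_triState x y z
  omega

end TriConf

/-! ### Membership in `conf` with an initial configuration -/

omit [Fintype V] in
/-- Membership in `conf` started from `ω₀`. [folklore] -/
theorem mem_conf_iff (a b c : V) (v : ℕ → V) (att : ℕ → Bool × Bool × Bool) (ω₀ : Finset (Sym2 V)) (e : Sym2 V) :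
    ∀ i, e ∈ conf a b c v att ω₀ i ↔ e ∈ ω₀ ∨ ∃ j, j < i ∧ e ∈ star (v j) (attFin a b c (att j).1 (att j).2.1 (att j).2.2) := by
  intro i
  induction i with
  | zero => simp [conf]
  | succ i ih =>
    simp only [conf, Finset.mem_union, ih]
    constructor
    · rintro ((h | ⟨j, hj, h⟩) | h)
      · exact Or.inl h
      · exact Or.inr ⟨j, by omega, h⟩
      · exact Or.inr ⟨i, by omega, h⟩
    · rintro (h | ⟨j, hj, h⟩)
      · exact Or.inl (Or.inl h)
      · rcases Nat.lt_succ_iff_lt_or_eq.1 hj with hj' | rfl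
        · exact Or.inl (Or.inr ⟨j, hj', h⟩)
        · exact Or.inr h

/-! ### Rigid leaf products on a basis vector -/

/-- The product of the first `i` rigid leaf letters times `e_{π₀}` is the rigid product `zvecB` started at `π₀`. [folklore] -/
theorem prod_leafB_mul_basisVec (q : ℝ) (att : ℕ → Bool × Bool × Bool) (π₀ : P3) (i : ℕ) :
    (∏ j ∈ Finset.range i, leafB q (att j).1 (att j).2.1 (att j).2.2) * basisVec π₀ = zvecB q att π₀ i := by
  induction i with
  | zero => rw [Finset.prod_range_zero, one_mul]; rfl
  | succ i ih => rw [Finset.prod_range_succ, mul_comm _ (leafB q _ _ _), mul_assoc, ih, zvecB, mul_def]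

end ThreeApex

end FK

end Summit.CriticalPhenomena.PercolationContinuityZ3.Theorems

end
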